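import Mathlib
import Literature.MathematicalPhysics.QuantumFieldTheory.Balaban1983to89.B10Eq32RegularSuN
import Literature.MathematicalPhysics.QuantumFieldTheory.SUNBakryEmeryPoincare
import Literature.Barriers.QuantumFields.UnitaryHaarSmallBall

/-
Copyright: publication-cell `pub-balaban` (b2b), seat b2b-balaban-b10 gen 29 (v1).  Literature leaf — `SU(N)`,
`U(N) ⊂ M_N(ℂ)`, one-variable complex analysis on a strip (identity principle), and one-line applications of the
cell's landed theorems only (`…B10Eq32RegularSuN` (gen 28) and, through it, `…B10Eq32AxialSuN`, `…B10Eq26SiteGauge`,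
`…B10Eq26TubeIdentity`, `…B10Eq29TubeLine`, `…B10Eq61PerSite`, `…B13Inv214Orbit`, `…B13Inv214OrbitSUN`,
`…B7Prop1Explicit`, `…B7Prop1Local`, `…B7Prop2SpecialUnitary`; the TREE's `…QuantumFieldTheory.SUNBakryEmeryPoincare`
(`exp : 𝔰𝔲(N) → SU(N)` onto) and `Literature.Barriers.QuantumFields.UnitaryHaarSmallBall` (the unitary logarithm),
all imported BY NAME, nothing edited); every theorem is kernel-proved and tagged [folklore] or [cite: …] (a LOCATED
printed shape); the objects are MODEL OBJECTS (functions of finitely many matrix variables), never asserted to be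
Bałaban's; NO new cited facts, NO summit vocabulary.
-/

/-!
# `Balaban1983to89.B10Eq26SuSlice` — [Balaban1985UV3] pp. 262–264, the gauge invariance (26) *"for all regular
# gauge field configurations"* AND the *"analyticity with respect to U₁"*: in the lineage's model the LOCATED (26) of
# `…B10Eq32RegularSuN` (gen 28: (26) only on the regular `SU(N)`-valued configurations `regSU N lo hi α′`) and the
# GLOBAL (26) of `…B10Eq32AxialSuN` (gen 27: b13's `SiteGaugeInvSU`, (26) at every `SU(N)`-valued configuration) are
# EQUIVALENT for every function holomorphic on the bondwise tube — an `SU(N)`-slice identity principle — and gen 28's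
# located joint theorem holds WITHOUT its side condition `α ≤ α′`

T. Bałaban, *Ultraviolet stability of three-dimensional lattice pure gauge field theories*, Commun. Math. Phys.
**102**, 255–275 (1985) [Balaban1985UV3] (cell paper B10; PDF `paper:balaban1985-cmp102-uv-stability-3d`, journal page
= PDF page + 254).

CITATION HEADER (lean-in-tree rule).  The passages of B10 marked «p008», «p009», «p010» below were READ AS IMAGE for
this module from the renders `b2b-balaban-ref1/pages/1985-cmp102-uv-stability-3d/1985-cmp102-uv-stability-3d-pNNN-
x2.png`, NNN = 008 (journal p. 262: the sentence introducing the three properties of `𝒫′₁`), 009 (p. 263: (26), the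
localization and analyticity properties, (29)), 010 (p. 264: (31), (32) and the sentence *"(26) holds for all regular
gauge field configurations"*).
This module adds NO cited fact; the manuscript under audit is quoted for the SHAPES of hypotheses, never cited for a
disputed step.  Siblings used BY NAME (byte-identical, nothing edited): `…B10Eq32RegularSuN` (b10 gen 28: `regSU`,
`mem_regSU_of_norm_sub_one_le`, `apply_gaugeAct_eq_of_orbitConstOnIn_regSU`, `orbitConstOnIn_regSU_of_siteGaugeInvSU`,
`eventually_norm_exp_smul_sub_one_lt`, `located26_strictly_weaker`; its joint theorem
`logHalfBound_sub_box_of_orbitConstOnIn_regSU` only in a compile-time `example`), `…B10Eq32AxialSuN` (b10 gen 27: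
`BoxBond`, `boxEnds`, `extCfg`, `exp_smul_mem_specialUnitaryGroup`, `logHalfBound_sub_box_of_siteGaugeInvSU`),
`…B10Eq26SiteGauge` (b10 gen 25: `SiteGaugeInv`, `differentiable_gaugeAct_cfg`, `gaugeAct_mem_tubeCfg_of_unitary`),
`…B10Eq26TubeIdentity` (b10 gen 24: `eqOn_tubeCfg_of_eqOn_unitary`), `…B10Eq29TubeLine` (b10 gen 23:
`cstarAlgebraMatrix`, `Tube`, `TubeCfg`, `exp_smul_mul_mem_tube_of_mem_rect`, `differentiable_exp_smul_mul`,
`exp_ofReal_smul_mem_unitary`), `…B10Eq61PerSite` (b10: `Rect`, `mem_rect`, `isOpen_rect`, `zero_mem_rect`),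
`…B13Inv214Orbit` (b13: `Ends`, `gaugeAct`), `…B13Inv214OrbitSUN` (b13 gen 22: `OrbitConstOnIn`, `SiteGaugeInvSU`,
`SubTube`, `eqOn_subTube_of_eqOn_specialUnitary`, `siteGaugeInvSU_subTube`), `…B7Prop1Explicit` (b07: `Site`, `l1`),
`…B7Prop1Local` (b07: `InBox`, `PlaqIn`), `…B7Prop2SpecialUnitary` (b07: `specialUnitaryUnits`, `thetaN`),
`…B10Eq27AxialLog` (b10 gen 26: `plaq`); OUTSIDE THE CELL, BY NAME: `SUNBakryEmery.exists_skew_traceless_exp_eq`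
(module `Literature.MathematicalPhysics.QuantumFieldTheory.SUNBakryEmeryPoincare`: every element of `SU(N)` is
`exp Y`, `Y` skew-Hermitian traceless) and `Literature.Barriers.QuantumFields.exists_uCoords_eq`, `uHerm_isSelfAdjoint`
(every unitary matrix is `e^{iH}`, `H` Hermitian).

WHY THIS MODULE (the open edge it closes, by name).  `…B10Eq32RegularSuN` (gen 28) restated the lineage's `SU(N)`
joint theorem with the gauge invariance (26) assumed only on the SPACE OF REGULAR CONFIGURATIONS `regSU N lo hi α′`
(«p010»: *"We have to notice only that (26) holds for all regular gauge field configurations, not only for the minimal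
configurations U₁."*), typed as b13's relative orbit constancy `OrbitConstOnIn … (specialUnitaryUnits (Fin N)) …
(regSU N lo hi α′)`, proved gen 27's GLOBAL hypothesis `SiteGaugeInvSU` ⇒ the located one, showed by a toy
(`located26_strictly_weaker`) that the located PREDICATE is strictly weaker, and left open in its HONEST SCOPE (v)
whether the weakening has content for the functions the joint theorem is about — functions HOLOMORPHIC on the bondwise
tube `TubeCfg` (binders `hsp : TubeCfg … a ⊆ sp X`, `hE : DifferentiableOn ℂ (E X) (sp X)`; print's third property,
«p009»: *"The third property is the analyticity with respect to U₁."*).  THIS MODULE answers: NO.  For a function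
holomorphic on the bondwise `a`-tube (any `a > 0`), invariance under the `SU(N)`-valued site transformations at the
`SU(N)`-valued configurations BONDWISE `δ`-NEAR `1` (any `δ > 0`) already forces (26) at EVERY `SU(N)`-valued
configuration (§3, `siteGaugeInvSU_of_invariant_near_one`), because two tube-holomorphic functions agreeing on the
`SU(N)`-valued configurations near `1` agree on all of them (§2, THE `SU(N)`-SLICE IDENTITY PRINCIPLE
`eq_on_specialUnitary_of_eq_near_one`); the configurations bondwise `α′/4`-near `1` are regular (gen 28), so located
(26) on `regSU N lo hi α′` ⇔ global (26) under the holomorphy binder (§3, `orbitConstOnIn_regSU_iff_siteGaugeInvSU`),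
and gen 28's located joint theorem follows from gen 27's global one for EVERY `α′ > 0`, its side condition `α ≤ α′`
dropped (§3, `logHalfBound_sub_box_of_orbitConstOnIn_regSU_any`).  §4 draws the consequence for gen 28's strictness
witnesses (none is holomorphic on any bondwise tube); §1 supplies the generators (`exp : 𝔰𝔲(N) → SU(N)` and
`𝔲(N) → U(N)` onto, the tree's theorems BY NAME); the `U(N)` companions (gen 25's `SiteGaugeInv`, gen 24's tube
identity) are carried along.

WHAT IS PRINTED (verbatim).
* B10 p. 262–263 («p008», «p009»): *"Besides the bounds (25) the expressions 𝒫′₁ have three very important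
  properties. The first is gauge invariance with respect to all gauge transformations of the configuration U₁, i.e.
  the following equalities hold 𝒫′₁(g₀, X, U₁ᵘ) = 𝒫′₁(g₀, X, U₁), (26) for all gauge transformations 𝓊. The second
  is a localization property with respect to U₁."*; *"The third property is the analyticity with respect to U₁. These
  properties follow from the results of previous papers; let us make a comment only on the gauge invariance (26)."*;
  *"By the gauge invariance (26), we have 𝒫′₁(g₀, X, U₁) = 𝒫′₁(g₀, X, exp i𝓗(B)), (29)"*.
* B10 p. 264 («p010»): *"The gauge invariance (26) implies the invariance with respect to the global transformations
  R(U), U ∈ G, hence the equality R(U)((δ/δ𝓗(b))𝒫′₁)(g₀, X, 1) = ((δ/δ𝓗(b))𝒫′₁)(g₀, X, 1). (31) We have to notice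
  only that (26) holds for all regular gauge field configurations, not only for the minimal configurations U₁. The
  derivative in the above formula is an element of the Lie algebra 𝔤, and by the assumption that 𝔤 is semi-simple,
  the only element invariant is 0, and we conclude ((δ/δ𝓗(b))𝒫′₁)(g₀, X, 1) = 0. (32)"*.

THE MATHEMATICS ([folklore]; three remarks).  (M1) GENERATORS.  Every `W ∈ SU(N)` is `exp X` with `X⋆ = −X`,
`tr X = 0` (diagonalise, take logarithms of the unit-modulus eigenvalues with total phase `0`); every unitary `W` is
`exp X` with `X⋆ = −X` (`X = iH`, `H` a Hermitian logarithm).  For such `X` and REAL `t`, `exp(tX)` is unitary, and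
in `SU(N)` when `tr X = 0` (`det exp = exp tr`).  (M2) THE STRIP.  The bondwise tube of half-width `a` is `{V :
V_b = exp(B_b)U_b, ‖B_b‖ < a, U_b unitary}`; for `X_b` skew-Hermitian with `‖X_b‖ ≤ κ` and `ζ = s + it` in the
strip `|t| < a/κ` (ALL real parts `s`), `exp(ζX_b) = exp(itX_b)·exp(sX_b)` with `itX_b` of norm `< a` and `exp(sX_b)`
unitary, so the entire curve `ζ ↦ (exp(ζX_b))_b` maps the open convex strip into the tube (gen 23's
`exp_smul_mul_mem_tube_of_mem_rect`), passes through `1` at `ζ = 0` and through `(exp X_b)_b` at `ζ = 1`, and is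
bondwise `δ`-near `1` for real `ζ` near `0`.  (M3) IDENTITY PRINCIPLE.  If `φ`, `ψ` are holomorphic on the tube and
agree at the `SU(N)`-valued (resp. unitary-valued) configurations bondwise `δ`-near `1`, then for an `SU(N)`-valued
(resp. unitary-valued) target `V = (exp X_b)_b` as in (M1) the composites `φ ∘ c`, `ψ ∘ c` along the curve of (M2)
are analytic on the strip and agree at all real `ζ` near `0` (there `c(ζ)` is `SU(N)`-valued, resp. unitary, and
near `1`), a set accumulating at `0`; by the one-variable identity principle on the (pre)connected strip they agree
on it, in particular at `ζ = 1`: `φ(V) = ψ(V)`.  Applied to `φ = F ∘ (·)ᵘ` and `ψ = F` (a site transformation with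
unitary values maps the tube to itself, half-width preserved — gen 25), invariance near `1` is invariance at every
`SU(N)`-valued configuration; and the `SU(N)`-valued configurations bondwise `α′/4`-near `1` lie in `regSU N lo hi
α′`, which is stable under the `SU(N)`-valued site transformations (gen 28 §4–§5), so the located (26) supplies the
invariance near `1`.

HYPOTHESIS SHAPES (never discharged here; each a LOCATED printed shape or a lineage binder BY NAME).  Holomorphy on
the bondwise tube `DifferentiableOn ℂ F (TubeCfg ι M_N(ℂ) a)`, `0 < a` — «p009» *"the analyticity with respect to
U₁"* in the lineage's model (gen 23's `TubeCfg`; the joint theorems' `hsp`, `hE`); located (26) `OrbitConstOnIn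
(boxEnds lo hi) (specialUnitaryUnits (Fin N)) F (regSU N lo hi α′)`, `0 < α′` — «p009» (26) with «p010» *"for all
regular gauge field configurations"* (gen 28's `h26` verbatim); invariance near `1`: `∀ u` `SU(N)`-valued, `∀ V`
`SU(N)`-valued with `∀ b, ‖V b − 1‖ < δ`, `F (gaugeAct γ u V) = F V` (the weakest located form, any finite carrier);
in §3's last theorem gen 28's binders verbatim, minus `hαα′ : α ≤ α′`.

HONEST SCOPE.  (i) As in the whole lineage, `F`, `E`, `sp`, `sp′`, the box, `α`, `α′`, `a` are MODEL OBJECTS: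
nothing here asserts that Bałaban's `𝒫′₁(g₀, X, ·)` satisfies the hypotheses.  (ii) THE POINT OF THE MODULE IS A
LIMITATION OF THE LINEAGE'S MODEL, stated as theorems: the lineage models print's *"analyticity with respect to U₁"*
by holomorphy on the bondwise tube `TubeCfg … a`, a complex neighbourhood of ALL unitary-valued configurations
(regular or not); on that class of functions the restriction of (26) to the regular configurations — the content of
print's sentence «p010» — is VOID (§3: located ⇔ global).  In print the analyticity domain is itself LOCATED (a
complex neighbourhood of the regular configurations, [Balaban1985UV3] (13) and its references), and on such a domain
the located (26) is genuinely weaker; modelling a located holomorphy domain (a tube over `regSU` only, on which the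
strip argument of (M2) fails for large generators and print's smallness (28) of `𝓗(B)` becomes load-bearing) is NOT
done here and is the natural next edge of the lineage.  (iii) `N ≥ 1` (`[NeZero N]`) for the `SU(N)` statements (the
generator needs an index to absorb the total phase); the `U(N)` statements for every `N`.  (iv) Carriers: §2 and the
first theorems of §3 on any finite bond set `ι` with any site set `S` and ends map `γ`; the `regSU` statements on a
box of `ℤ^d` (gen 27/28's `BoxBond lo hi`, `boxEnds lo hi`), not print's torus.  (v) The two generator theorems of
§1 are the tree's (`SUNBakryEmery.exists_skew_traceless_exp_eq`, `Literature.Barriers.QuantumFields.exists_uCoords_eq`)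
restated in the lineage's hypothesis shapes (`star X = −X`); nothing about them is new.

COLLISION MAP.  Gen 24 (`…B10Eq26TubeIdentity`): the tube identity principle from agreement on ALL unitary-valued
configurations (`eqOn_tubeCfg_of_eqOn_unitary`) and b13 gen 22 (`eqOn_subTube_of_eqOn_specialUnitary`, from ALL
`SU(N)`-valued ones) are used BY NAME as the second step; NEW here is the first step, from the configurations NEAR `1`
to all `SU(N)`-valued (resp. unitary-valued) ones (a different curve: the exponential strip through `1`, not gen 24's polar slice
through a tube point).  Gen 28 §1–§2 (`HasDerivAt.congr_of_eventuallyEq`: the DERIVATIVE at `1` only sees (26) near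
`1`) is the infinitesimal shadow of §3 and is not restated.  Gen 27's `exp_smul_mem_specialUnitaryGroup` and the tree's
`T4AdjointCovarianceUnitary.exp_mem_specialUnitaryGroup_of_mem_lieSU` (forward direction `𝔰𝔲(N) → SU(N)`) BY NAME /
not restated; the converse (ontoness) is the tree's `SUNBakryEmery.exists_skew_traceless_exp_eq` BY NAME.  NEW here:
`eq_at_exp_of_eq_near_one` and its `SU(N)`/`U(N)` corollaries, the near-`1` ⇒ global (26) theorems, the equivalence
located ⇔ global on `regSU`, the `α ≤ α′`-free located joint theorem, the non-holomorphy of separating functions.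
-/

namespace Literature.MathematicalPhysics.QuantumFieldTheory.Balaban1983to89.B10Eq26SuSlice

open NormedSpace Set Metric Filter Complex
open scoped Topology Matrix.Norms.L2Operator

/-! ## §1. GENERATORS: `exp : 𝔰𝔲(N) → SU(N)` AND `exp : 𝔲(N) → U(N)` ARE ONTO (the tree's theorems BY NAME, in the
## lineage's hypothesis shapes) -/

section sulog

variable {N : ℕ}

attribute [local instance] B10Eq29TubeLine.cstarAlgebraMatrix

/-- `M_N(ℂ)`. -/
local notation "M[" N "]" => Matrix (Fin N) (Fin N) ℂ

/-- **`exp : 𝔰𝔲(N) → SU(N)` IS ONTO**, in the lineage's hypothesis shapes (`star X = −X`, `tr X = 0`, as in gen 27's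
`exp_smul_mem_specialUnitaryGroup`): every `W ∈ SU(N)` is `exp X` with `X` skew-Hermitian and traceless.  This is
the TREE's `SUNBakryEmery.exists_skew_traceless_exp_eq` (module `…QuantumFieldTheory.SUNBakryEmeryPoincare`) BY NAME (diagonalise in `SU(N)`, take logarithms of
the eigenvalues with total phase `0`), restated with `star` for `ᴴ`; nothing is re-proved. [folklore] -/
theorem exists_su_generator [NeZero N] {W : M[N]} (hW : W ∈ Matrix.specialUnitaryGroup (Fin N) ℂ) :
    ∃ X : M[N], star X = -X ∧ Matrix.trace X = 0 ∧ exp X = W := by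
  obtain ⟨Y, hY, hY0, hYW⟩ := SUNBakryEmery.exists_skew_traceless_exp_eq (NeZero.ne N) ⟨W, hW⟩
  exact ⟨Y, (Matrix.star_eq_conjTranspose Y).trans hY, hY0, hYW⟩

/-- **`exp : 𝔲(N) → U(N)` IS ONTO** (the `U(N)` companion): every unitary matrix is `exp X` with `X` skew-Hermitian —
the TREE's unitary logarithm `Literature.Barriers.QuantumFields.exists_uCoords_eq` (`U = e^{iH}`, `H = uHerm x`
Hermitian, by the continuous functional calculus) BY NAME, `X = iH`. [folklore] -/
theorem exists_u_generator {W : M[N]} (hW : W ∈ Matrix.unitaryGroup (Fin N) ℂ) :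
    ∃ X : M[N], star X = -X ∧ exp X = W := by
  obtain ⟨x, -, hx⟩ := Literature.Barriers.QuantumFields.exists_uCoords_eq ⟨W, hW⟩
  refine ⟨I • Literature.Barriers.QuantumFields.uHerm x, ?_, ?_⟩
  · rw [star_smul, Complex.star_def, Complex.conj_I,
      (Literature.Barriers.QuantumFields.uHerm_isSelfAdjoint x).star_eq, neg_smul]
  · exact congrArg (fun v : Matrix.unitaryGroup (Fin N) ℂ => (v : M[N])) hx

end sulog

/-! ## §2. THE `SU(N)`-SLICE IDENTITY PRINCIPLE ON THE BONDWISE TUBE -/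

section slice

variable {N : ℕ} {ι : Type*} [Fintype ι]

attribute [local instance] B10Eq29TubeLine.cstarAlgebraMatrix

/-- `M_N(ℂ)`. -/
local notation "M[" N "]" => Matrix (Fin N) (Fin N) ℂ

open B10Eq61PerSite (Rect mem_rect isOpen_rect zero_mem_rect segment_subset_rect)
open B10Eq29TubeLine (Tube TubeCfg exp_smul_mul_mem_tube_of_mem_rect differentiable_exp_smul_mul
  exp_ofReal_smul_mem_unitary)
open B10Eq32AxialSuN (exp_smul_mem_specialUnitaryGroup)
open B10Eq32RegularSuN (eventually_norm_exp_smul_sub_one_lt)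

/-- The strip `Rect h` is convex (an intersection of four open half-planes). [folklore] -/
theorem convex_rect (h : ℝ) : Convex ℝ (Rect h) := by
  have e : Rect h = {ζ : ℂ | -h < Complex.imLm ζ} ∩ {ζ : ℂ | Complex.imLm ζ < h} ∩
      {ζ : ℂ | -h < Complex.reLm ζ} ∩ {ζ : ℂ | Complex.reLm ζ < 1 + h} := by
    ext ζ; simp only [mem_rect, mem_inter_iff, mem_setOf_eq, Complex.imLm_coe, Complex.reLm_coe]; tauto
  rw [e]
  exact (((convex_halfSpace_gt Complex.imLm.isLinear _).inter (convex_halfSpace_lt Complex.imLm.isLinear _)).inter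
    (convex_halfSpace_gt Complex.reLm.isLinear _)).inter (convex_halfSpace_lt Complex.reLm.isLinear _)

/-- `1 ∈ Rect h` for `h > 0`. [folklore] -/
theorem one_mem_rect {h : ℝ} (hh : 0 < h) : (1 : ℂ) ∈ Rect h :=
  segment_subset_rect hh (right_mem_segment ℝ (0 : ℂ) 1)

/-- Real points NEAR `0` are frequent in the punctured neighbourhood of `0 ∈ ℂ`: a property holding for all real
`t` near `0` holds frequently along `𝓝[≠] (0 : ℂ)` (the punctured ball `B(0, ε) ∖ {0}` contains the real point
`min(ε, η)/2`).  Variant of gen 24's `B10Eq26TubeIdentity.frequently_nhdsNE_zero_of_forall_ofReal` (there: ALL real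
`t`). [folklore] -/
theorem frequently_nhdsNE_zero_of_eventually_ofReal {p : ℂ → Prop} (hp : ∀ᶠ t : ℝ in 𝓝 0, p t) :
    ∃ᶠ z in 𝓝[≠] (0 : ℂ), p z := by
  rw [Filter.frequently_iff]
  intro s hs
  obtain ⟨ε, hε, hsub⟩ := Metric.mem_nhdsWithin_iff.1 hs
  obtain ⟨η, hη, hηp⟩ := Metric.eventually_nhds_iff.1 hp
  have hm : 0 < min ε η / 2 := by positivity
  refine ⟨((min ε η / 2 : ℝ) : ℂ), hsub ⟨?_, ?_⟩, hηp ?_⟩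
  · rw [Metric.mem_ball, dist_zero_right, Complex.norm_real, Real.norm_eq_abs, abs_of_pos hm]
    exact (half_lt_self (lt_min hε hη)).trans_le (min_le_left _ _)
  · rw [mem_compl_iff, mem_singleton_iff, Complex.ofReal_eq_zero]
    exact hm.ne'
  · rw [Real.dist_eq, sub_zero, abs_of_pos hm]
    exact (half_lt_self (lt_min hε hη)).trans_le (min_le_right _ _)

/-- **THE CORE STRIP ARGUMENT.**  `φ`, `ψ` holomorphic on the bondwise `a`-tube (`a > 0`) and equal at the
configurations which satisfy a predicate `P` and are bondwise `δ`-near `1`; `X` a configuration of skew-Hermitian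
GENERATORS such that the real exponential ray `t ↦ (exp(tX_b))_b` satisfies `P`.  Then `φ = ψ` at `(exp X_b)_b`: the
one-variable curve `ζ ↦ (exp(ζX_b))_b` is entire, lies in the tube on the strip `Rect (a/κ)` (`κ ≥ ‖X_b‖`; gen 23's
`exp_smul_mul_mem_tube_of_mem_rect` — the REAL direction is free), and is bondwise `δ`-near `1` for real `ζ` near `0`
(gen 28's `eventually_norm_exp_smul_sub_one_lt`), so the two composites are analytic on the open convex strip and
agree at the real points near `0`, hence on the strip (`AnalyticOnNhd.eqOn_of_preconnected_of_frequently_eq`), in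
particular at `ζ = 1`. [folklore] -/
theorem eq_at_exp_of_eq_near_one {a δ : ℝ} (ha : 0 < a) (hδ : 0 < δ) {φ ψ : (ι → M[N]) → ℂ}
    (hφ : DifferentiableOn ℂ φ (TubeCfg ι M[N] a)) (hψ : DifferentiableOn ℂ ψ (TubeCfg ι M[N] a))
    {P : (ι → M[N]) → Prop} (h : ∀ W : ι → M[N], P W → (∀ b, ‖W b - 1‖ < δ) → φ W = ψ W)
    {X : ι → M[N]} (hXs : ∀ b, star (X b) = -X b) (hP : ∀ t : ℝ, P (fun b => exp ((t : ℂ) • X b))) :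
    φ (fun b => exp (X b)) = ψ (fun b => exp (X b)) := by
  have hXs' : ∀ b, X b ∈ skewAdjoint M[N] := fun b => skewAdjoint.mem_iff.mpr (hXs b)
  -- a common bound `κ ≥ ‖X_b‖`, `κ > 0`
  set κ : ℝ := 1 + ∑ b, ‖X b‖ with hκdef
  have hκ0 : 0 < κ := by positivity
  have hXκ : ∀ b, ‖X b‖ ≤ κ := fun b =>
    (Finset.single_le_sum (fun b _ => norm_nonneg (X b)) (Finset.mem_univ b)).trans (by linarith)
  have haκ : 0 < a / κ := div_pos ha hκ0
  -- the curve `ζ ↦ (exp(ζ X_b) · 1)_b`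
  set c : ℂ → (ι → M[N]) := fun ζ b => exp (ζ • X b) * 1 with hcdef
  have hc : Differentiable ℂ c := differentiable_pi.mpr fun b => differentiable_exp_smul_mul (X b) 1
  have hmaps : MapsTo c (Rect (a / κ)) (TubeCfg ι M[N] a) := fun ζ hζ b =>
    exp_smul_mul_mem_tube_of_mem_rect (hXs' b) (one_mem _) hκ0 (hXκ b) hζ
  have hf : AnalyticOnNhd ℂ (φ ∘ c) (Rect (a / κ)) :=
    (hφ.comp hc.differentiableOn hmaps).analyticOnNhd (isOpen_rect _)
  have hg : AnalyticOnNhd ℂ (ψ ∘ c) (Rect (a / κ)) :=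
    (hψ.comp hc.differentiableOn hmaps).analyticOnNhd (isOpen_rect _)
  -- at the real points near `0` the curve satisfies `P` and is bondwise `δ`-near `1`
  have hreal : ∀ᶠ t : ℝ in 𝓝 0, (φ ∘ c) t = (ψ ∘ c) t := by
    filter_upwards [eventually_norm_exp_smul_sub_one_lt X hδ] with t ht
    have hct : c t = fun b => exp ((t : ℂ) • X b) := funext fun b => mul_one _
    simp only [Function.comp_apply, hct]
    exact h _ (hP t) ht
  have hEq : EqOn (φ ∘ c) (ψ ∘ c) (Rect (a / κ)) :=
    hf.eqOn_of_preconnected_of_frequently_eq hg (convex_rect _).isPreconnected (zero_mem_rect haκ)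
      (frequently_nhdsNE_zero_of_eventually_ofReal hreal)
  have hc1 : c 1 = fun b => exp (X b) := funext fun b => by rw [hcdef]; simp only [one_smul, mul_one]
  have h1 := hEq (one_mem_rect haκ)
  simp only [Function.comp_apply, hc1] at h1
  exact h1

/-- **THE `SU(N)`-SLICE IDENTITY PRINCIPLE.**  Two functions holomorphic on the bondwise `a`-tube of `M_N(ℂ)^ι`
(`a > 0`) which agree at the `SU(N)`-VALUED configurations BONDWISE `δ`-NEAR `1` (any `δ > 0`) agree at EVERY
`SU(N)`-valued configuration: write the target `V_b = exp X_b` with `X_b ∈ 𝔰𝔲(N)` (§1) and run the core argument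
with `P` = "`SU(N)`-valued" (the ray `exp(tX_b)`, `t` real, is `SU(N)`-valued, gen 27's
`exp_smul_mem_specialUnitaryGroup`). [folklore] -/
theorem eq_on_specialUnitary_of_eq_near_one [NeZero N] {a δ : ℝ} (ha : 0 < a) (hδ : 0 < δ)
    {φ ψ : (ι → M[N]) → ℂ} (hφ : DifferentiableOn ℂ φ (TubeCfg ι M[N] a))
    (hψ : DifferentiableOn ℂ ψ (TubeCfg ι M[N] a))
    (h : ∀ V : ι → M[N], (∀ b, V b ∈ Matrix.specialUnitaryGroup (Fin N) ℂ) → (∀ b, ‖V b - 1‖ < δ) →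
      φ V = ψ V) :
    ∀ V : ι → M[N], (∀ b, V b ∈ Matrix.specialUnitaryGroup (Fin N) ℂ) → φ V = ψ V := by
  intro V hV
  choose X hXs hXt hXe using fun b => exists_su_generator (hV b)
  have hVX : V = fun b => exp (X b) := funext fun b => (hXe b).symm
  rw [hVX]
  exact eq_at_exp_of_eq_near_one ha hδ hφ hψ h hXs fun t b => exp_smul_mem_specialUnitaryGroup N (hXs b) (hXt b) t

/-- **THE `U(N)`-SLICE COMPANION.**  Agreement at the UNITARY-valued configurations bondwise `δ`-near `1` gives
agreement at every unitary-valued configuration (`P` = "unitary-valued", the ray is unitary by gen 23's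
`exp_ofReal_smul_mem_unitary`, the generator from §1's unitary logarithm). [folklore] -/
theorem eq_on_unitary_of_eq_near_one {a δ : ℝ} (ha : 0 < a) (hδ : 0 < δ)
    {φ ψ : (ι → M[N]) → ℂ} (hφ : DifferentiableOn ℂ φ (TubeCfg ι M[N] a))
    (hψ : DifferentiableOn ℂ ψ (TubeCfg ι M[N] a))
    (h : ∀ V : ι → M[N], (∀ b, V b ∈ unitary M[N]) → (∀ b, ‖V b - 1‖ < δ) → φ V = ψ V) :
    ∀ V : ι → M[N], (∀ b, V b ∈ unitary M[N]) → φ V = ψ V := by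
  intro V hV
  choose X hXs hXe using fun b => exists_u_generator (hV b)
  have hVX : V = fun b => exp (X b) := funext fun b => (hXe b).symm
  rw [hVX]
  exact eq_at_exp_of_eq_near_one ha hδ hφ hψ h hXs
    fun t b => exp_ofReal_smul_mem_unitary (skewAdjoint.mem_iff.mpr (hXs b)) t

open B13Inv214OrbitSUN (SubTube eqOn_subTube_of_eqOn_specialUnitary)

/-- **… HENCE ON THE WHOLE `Gᶜ = SL(N, ℂ)`-VALUED TUBE** (b13's sub-tube identity principle
`eqOn_subTube_of_eqOn_specialUnitary` BY NAME on top of the slice principle): agreement at the `SU(N)`-valued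
configurations bondwise `δ`-near `1` propagates to b13's `SubTube ι N a`. [folklore] -/
theorem eqOn_subTube_of_eq_near_one [NeZero N] {a δ : ℝ} (ha : 0 < a) (hδ : 0 < δ)
    {φ ψ : (ι → M[N]) → ℂ} (hφ : DifferentiableOn ℂ φ (TubeCfg ι M[N] a))
    (hψ : DifferentiableOn ℂ ψ (TubeCfg ι M[N] a))
    (h : ∀ V : ι → M[N], (∀ b, V b ∈ Matrix.specialUnitaryGroup (Fin N) ℂ) → (∀ b, ‖V b - 1‖ < δ) →
      φ V = ψ V) :
    EqOn φ ψ (SubTube ι N a) :=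
  eqOn_subTube_of_eqOn_specialUnitary hφ hψ (eq_on_specialUnitary_of_eq_near_one ha hδ hφ hψ h)

open B10Eq26TubeIdentity (eqOn_tubeCfg_of_eqOn_unitary)

/-- **… AND, IN THE `U(N)` CASE, ON THE WHOLE BONDWISE TUBE** (gen 24's tube identity principle
`eqOn_tubeCfg_of_eqOn_unitary` BY NAME on top of the `U(N)` companion): the germ of a tube-holomorphic function along
the unitary-valued configurations at `1` determines it on `TubeCfg ι M_N(ℂ) a`. [folklore] -/
theorem eqOn_tubeCfg_of_eq_near_one {a δ : ℝ} (ha : 0 < a) (hδ : 0 < δ)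
    {φ ψ : (ι → M[N]) → ℂ} (hφ : DifferentiableOn ℂ φ (TubeCfg ι M[N] a))
    (hψ : DifferentiableOn ℂ ψ (TubeCfg ι M[N] a))
    (h : ∀ V : ι → M[N], (∀ b, V b ∈ unitary M[N]) → (∀ b, ‖V b - 1‖ < δ) → φ V = ψ V) :
    EqOn φ ψ (TubeCfg ι M[N] a) :=
  eqOn_tubeCfg_of_eqOn_unitary hφ hψ (eq_on_unitary_of_eq_near_one ha hδ hφ hψ h)

end slice

/-! ## §3. THE LOCATED (26) HAS NO HOLOMORPHIC TEETH IN THE LINEAGE'S MODEL: located (26) on `regSU` + holomorphy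
## on the bondwise tube ⇒ (26) at every `SU(N)`-valued configuration -/

section located

variable {N : ℕ} [NeZero N] {ι S : Type*} [Fintype ι] {d : ℕ}

attribute [local instance] B10Eq29TubeLine.cstarAlgebraMatrix

/-- `M_N(ℂ)`. -/
local notation "M[" N "]" => Matrix (Fin N) (Fin N) ℂ

open B7Prop1Explicit renaming Site → LSite
open B7Prop1Explicit (l1)
open B7Prop1Local (InBox PlaqIn)
open B7Prop2SpecialUnitary (specialUnitaryUnits)
open B13Inv214Orbit (Ends gaugeAct)
open B13Inv214OrbitSUN (OrbitConstOnIn SiteGaugeInvSU SubTube siteGaugeInvSU_subTube)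
open B10Eq29TubeLine (TubeCfg expLine)
open B10Eq26SiteGauge (SiteGaugeInv differentiable_gaugeAct_cfg gaugeAct_mem_tubeCfg_of_unitary)
open B10Eq27AxialLog (plaq)
open B10Eq32AxialSuN (BoxBond boxEnds extCfg axialGenBox logHalfBound_sub_box_of_siteGaugeInvSU)
open B10Eq32RegularSuN (regSU mem_regSU_of_norm_sub_one_le apply_gaugeAct_eq_of_orbitConstOnIn_regSU
  orbitConstOnIn_regSU_of_siteGaugeInvSU logHalfBound_sub_box_of_orbitConstOnIn_regSU)

/-- **(26) NEAR `1` ⇒ (26) EVERYWHERE ON THE `SU(N)`-VALUED CONFIGURATIONS**, any finite carrier: if `F` is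
holomorphic on the bondwise `a`-tube and `F(𝐕ᵘ) = F(𝐕)` for all `SU(N)`-valued site transformations `u` at the
`SU(N)`-valued `𝐕` bondwise `δ`-near `1`, then b13's `SiteGaugeInvSU γ F` ((26) at EVERY `SU(N)`-valued `𝐕`) — §2
applied to `F ∘ (·)ᵘ` and `F` (`SU(N)`-valued `u` preserve the tube with its half-width, gen 25's
`gaugeAct_mem_tubeCfg_of_unitary`). [folklore] -/
theorem siteGaugeInvSU_of_invariant_near_one (γ : Ends ι S) {a δ : ℝ} (ha : 0 < a) (hδ : 0 < δ)
    {F : (ι → M[N]) → ℂ} (hF : DifferentiableOn ℂ F (TubeCfg ι M[N] a))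
    (h : ∀ u : S → M[N], (∀ x, u x ∈ Matrix.specialUnitaryGroup (Fin N) ℂ) →
      ∀ V : ι → M[N], (∀ b, V b ∈ Matrix.specialUnitaryGroup (Fin N) ℂ) → (∀ b, ‖V b - 1‖ < δ) →
        F (gaugeAct γ u V) = F V) :
    SiteGaugeInvSU γ F := by
  intro u hu V hV
  have hu' : ∀ x, u x ∈ unitary M[N] := fun x => (Matrix.mem_specialUnitaryGroup_iff.1 (hu x)).1
  exact eq_on_specialUnitary_of_eq_near_one ha hδ
    (hF.comp (differentiable_gaugeAct_cfg γ u).differentiableOn fun _ hW => gaugeAct_mem_tubeCfg_of_unitary γ hu' hW)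
    hF (fun W hW hWδ => h u hu W hW hWδ) V hV

/-- … and then on b13's whole `Gᶜ`-valued tube (`siteGaugeInvSU_subTube` BY NAME). [folklore] -/
theorem gaugeInv_subTube_of_invariant_near_one (γ : Ends ι S) {a δ : ℝ} (ha : 0 < a) (hδ : 0 < δ)
    {F : (ι → M[N]) → ℂ} (hF : DifferentiableOn ℂ F (TubeCfg ι M[N] a))
    (h : ∀ u : S → M[N], (∀ x, u x ∈ Matrix.specialUnitaryGroup (Fin N) ℂ) →
      ∀ V : ι → M[N], (∀ b, V b ∈ Matrix.specialUnitaryGroup (Fin N) ℂ) → (∀ b, ‖V b - 1‖ < δ) →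
        F (gaugeAct γ u V) = F V)
    {u : S → M[N]} (hu : ∀ x, u x ∈ Matrix.specialUnitaryGroup (Fin N) ℂ) :
    ∀ V ∈ SubTube ι N a, F (gaugeAct γ u V) = F V :=
  siteGaugeInvSU_subTube γ hF (siteGaugeInvSU_of_invariant_near_one γ ha hδ hF h) hu

omit [NeZero N] in
/-- **THE `U(N)` COMPANION**: invariance under the UNITARY-valued site transformations at the unitary-valued `𝐕`
bondwise `δ`-near `1`, plus holomorphy on the bondwise `a`-tube, gives gen 25's `SiteGaugeInv γ F` ((26) at every
unitary-valued `𝐕`, for `G = U(N)`), hence (gen 25's `siteGaugeInv_tube`) invariance on the whole tube. [folklore] -/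
theorem siteGaugeInv_of_invariant_near_one (γ : Ends ι S) {a δ : ℝ} (ha : 0 < a) (hδ : 0 < δ)
    {F : (ι → M[N]) → ℂ} (hF : DifferentiableOn ℂ F (TubeCfg ι M[N] a))
    (h : ∀ u : S → M[N], (∀ x, u x ∈ unitary M[N]) →
      ∀ V : ι → M[N], (∀ b, V b ∈ unitary M[N]) → (∀ b, ‖V b - 1‖ < δ) → F (gaugeAct γ u V) = F V) :
    SiteGaugeInv γ F := fun u hu V hV =>
  eq_on_unitary_of_eq_near_one ha hδ
    (hF.comp (differentiable_gaugeAct_cfg γ u).differentiableOn fun _ hW => gaugeAct_mem_tubeCfg_of_unitary γ hu hW)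
    hF (fun W hW hWδ => h u hu W hW hWδ) V hV

/-- **THE LOCATED (26) OF `…B10Eq32RegularSuN` IMPLIES THE GLOBAL (26) OF `…B10Eq32AxialSuN` UNDER THE JOINT
THEOREMS' OWN HOLOMORPHY BINDER**: on a finite box of `ℤ^d`, relative orbit constancy of `F` on the regular
`SU(N)`-valued configurations `regSU N lo hi α′` (ANY `α′ > 0`) together with holomorphy of `F` on the bondwise
`a`-tube (any `a > 0`) gives (26) at EVERY `SU(N)`-valued configuration of the box — the `SU(N)`-valued
configurations bondwise `α′/4`-near `1` are regular (gen 28 §4) and regularity is gauge invariant (gen 28 §5), so the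
near-`1` invariance holds, and §2 propagates it. [cite: Balaban1985UV3, (26) p.263 («The third property is the
analyticity with respect to U₁.»), p.264 («We have to notice only that (26) holds for all regular gauge field
configurations, not only for the minimal configurations U₁.»)] -/
theorem siteGaugeInvSU_of_orbitConstOnIn_regSU {lo hi : LSite d} {α' a : ℝ} (hα' : 0 < α') (ha : 0 < a)
    {F : (BoxBond lo hi → M[N]) → ℂ} (hF : DifferentiableOn ℂ F (TubeCfg (BoxBond lo hi) M[N] a))
    (h26 : OrbitConstOnIn (boxEnds lo hi) (specialUnitaryUnits (Fin N)) F (regSU N lo hi α')) :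
    SiteGaugeInvSU (boxEnds lo hi) F :=
  siteGaugeInvSU_of_invariant_near_one (boxEnds lo hi) ha (by positivity : 0 < α' / 4) hF
    fun _ hu _ hV hVδ => apply_gaugeAct_eq_of_orbitConstOnIn_regSU h26 hu
      (mem_regSU_of_norm_sub_one_le (by positivity) (by linarith) hV fun b => (hVδ b).le)

/-- **HENCE THE TWO HYPOTHESES ARE EQUIVALENT** for functions holomorphic on the bondwise tube: gen 28's located
(26) on `regSU N lo hi α′` (`α′ > 0`) ⇔ gen 27's global (26) (b13's `SiteGaugeInvSU`); `⇐` is gen 28's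
`orbitConstOnIn_regSU_of_siteGaugeInvSU` (every `α′`, no holomorphy). [folklore] -/
theorem orbitConstOnIn_regSU_iff_siteGaugeInvSU {lo hi : LSite d} {α' a : ℝ} (hα' : 0 < α') (ha : 0 < a)
    {F : (BoxBond lo hi → M[N]) → ℂ} (hF : DifferentiableOn ℂ F (TubeCfg (BoxBond lo hi) M[N] a)) :
    OrbitConstOnIn (boxEnds lo hi) (specialUnitaryUnits (Fin N)) F (regSU N lo hi α') ↔
      SiteGaugeInvSU (boxEnds lo hi) F :=
  ⟨siteGaugeInvSU_of_orbitConstOnIn_regSU hα' ha hF, fun h => orbitConstOnIn_regSU_of_siteGaugeInvSU h α'⟩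

variable (N) in
/-- **GEN 28'S LOCATED JOINT THEOREM FROM GEN 27'S GLOBAL ONE, WITH THE SIDE CONDITION `α ≤ α′` DROPPED**: under the
joint theorems' binders `hsp`/`hE` (holomorphy of every `E X` on `sp X ⊇` the bondwise `a`-tube) the located
hypothesis `∀ X, OrbitConstOnIn (boxEnds lo hi) (specialUnitaryUnits (Fin N)) (E X) (regSU N lo hi α′)` for ANY
`α′ > 0` — however small compared with the plaquette regularity `α` of the gauge-fixed configurations — yields gen
27's `h26`, so gen 27's `logHalfBound_sub_box_of_siteGaugeInvSU` applies verbatim.  (Gen 28's own proof needs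
`α ≤ α′` to place `sp′ X` inside `regSU`; through the identity principle that containment is not needed.)
[cite: Balaban1985UV3, (26) p.263, p.264 («for all regular gauge field configurations»), (27)–(29) p.263,
(31)–(32) p.264] -/
theorem logHalfBound_sub_box_of_orbitConstOnIn_regSU_any {lo hi : LSite d} {D : LocDomainSys} {B r a p q : ℝ}
    (ha : 0 < a) (hp : 0 ≤ p) (hq : 0 ≤ q) (hpq : 0 < p + q) (hB : 0 ≤ B) (y : D.Dom → LSite d)
    (hy : ∀ X, InBox lo hi (y X)) (R : D.Dom → ℕ) {α α' : ℝ} (hα : 0 ≤ α) (hα' : 0 < α')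
    (hR4 : ∀ X, (R X : ℝ) * α ≤ 1 / 4) (hRπ : ∀ X, (N : ℝ) * ((R X : ℝ) * α) < Real.pi)
    (hRpq : ∀ X, 2 * ((R X : ℝ) * α) ≤ p + q * (1 + D.dj X))
    {E : D.Dom → (BoxBond lo hi → M[N]) → ℂ} {sp' sp : D.Dom → Set (BoxBond lo hi → M[N])}
    {dep : D.Dom → Set (BoxBond lo hi)} {nX : D.Dom → ℕ}
    (hsp : ∀ X, TubeCfg (BoxBond lo hi) M[N] a ⊆ sp X) (hE : ∀ X, DifferentiableOn ℂ (E X) (sp X))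
    (h26 : ∀ X, OrbitConstOnIn (boxEnds lo hi) (specialUnitaryUnits (Fin N)) (E X) (regSU N lo hi α'))
    (hEb : B13.LogHalfBound D sp E nX B r)
    (hloc : ∀ X (V V' : BoxBond lo hi → M[N]), (∀ b ∈ dep X, V b = V' b) → E X V = E X V')
    (hSU : ∀ X φ, φ ∈ sp' X → ∀ b, φ b ∈ Matrix.specialUnitaryGroup (Fin N) ℂ)
    (h13 : ∀ X φ, φ ∈ sp' X → ∀ (x : LSite d) (κ μ : Fin d), κ ≠ μ → PlaqIn lo hi (x, κ, μ) →
      ‖plaq (extCfg lo hi φ) x κ μ - 1‖ ≤ α)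
    (hdep : ∀ X, ∀ b ∈ dep X, l1 (b.1.1 - y X) ≤ R X) :
    B13.LogHalfBound D sp' (fun X φ => E X φ - E X (fun _ => 1)) nX (8 * ((p + q) / a) ^ 2 * B) (r - 2) :=
  logHalfBound_sub_box_of_siteGaugeInvSU N ha hp hq hpq hB y hy R hα hR4 hRπ hRpq hsp hE
    (fun X => siteGaugeInvSU_of_orbitConstOnIn_regSU hα' ha ((hE X).mono (hsp X)) (h26 X)) hEb hloc hSU h13 hdep

/-- Compile-time check: under gen 28's EXACT binder list (with its `hαα′ : α ≤ α′`) the conclusion of gen 28's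
`logHalfBound_sub_box_of_orbitConstOnIn_regSU` is delivered by the theorem above with `hαα′` unused — the binder
lists line up name for name. [folklore] -/
example {lo hi : LSite d} {D : LocDomainSys} {B r a p q : ℝ}
    (ha : 0 < a) (hp : 0 ≤ p) (hq : 0 ≤ q) (hpq : 0 < p + q) (hB : 0 ≤ B) (y : D.Dom → LSite d)
    (hy : ∀ X, InBox lo hi (y X)) (R : D.Dom → ℕ) {α α' : ℝ} (hα : 0 ≤ α) (hα' : 0 < α') (_hαα' : α ≤ α')
    (hR4 : ∀ X, (R X : ℝ) * α ≤ 1 / 4) (hRπ : ∀ X, (N : ℝ) * ((R X : ℝ) * α) < Real.pi)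
    (hRpq : ∀ X, 2 * ((R X : ℝ) * α) ≤ p + q * (1 + D.dj X))
    {E : D.Dom → (BoxBond lo hi → M[N]) → ℂ} {sp' sp : D.Dom → Set (BoxBond lo hi → M[N])}
    {dep : D.Dom → Set (BoxBond lo hi)} {nX : D.Dom → ℕ}
    (hsp : ∀ X, TubeCfg (BoxBond lo hi) M[N] a ⊆ sp X) (hE : ∀ X, DifferentiableOn ℂ (E X) (sp X))
    (h26 : ∀ X, OrbitConstOnIn (boxEnds lo hi) (specialUnitaryUnits (Fin N)) (E X) (regSU N lo hi α'))
    (hEb : B13.LogHalfBound D sp E nX B r)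
    (hloc : ∀ X (V V' : BoxBond lo hi → M[N]), (∀ b ∈ dep X, V b = V' b) → E X V = E X V')
    (hSU : ∀ X φ, φ ∈ sp' X → ∀ b, φ b ∈ Matrix.specialUnitaryGroup (Fin N) ℂ)
    (h13 : ∀ X φ, φ ∈ sp' X → ∀ (x : LSite d) (κ μ : Fin d), κ ≠ μ → PlaqIn lo hi (x, κ, μ) →
      ‖plaq (extCfg lo hi φ) x κ μ - 1‖ ≤ α)
    (hdep : ∀ X, ∀ b ∈ dep X, l1 (b.1.1 - y X) ≤ R X) :
    B13.LogHalfBound D sp' (fun X φ => E X φ - E X (fun _ => 1)) nX (8 * ((p + q) / a) ^ 2 * B) (r - 2) :=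
  logHalfBound_sub_box_of_orbitConstOnIn_regSU_any N ha hp hq hpq hB y hy R hα hα' hR4 hRπ hRpq hsp hE h26 hEb
    hloc hSU h13 hdep

end located

/-! ## §4. WHAT THE EQUIVALENCE SAYS ABOUT GEN 28'S STRICTNESS WITNESSES

Gen 28's `located26_strictly_weaker` separates the two PREDICATES — located (26) on `regSU` versus b13's global
`SiteGaugeInvSU` — by a function which is `0` on `regSU` and `‖V(b₀) − 1‖` off it.  §3 says that every such
separating function fails to be holomorphic on every bondwise tube: in the lineage's model the located weakening
has no content for the functions the joint theorems are about (HONEST SCOPE (ii) of the header). -/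

section teeth

variable {N : ℕ} [NeZero N] {d : ℕ}

attribute [local instance] B10Eq29TubeLine.cstarAlgebraMatrix

/-- `M_N(ℂ)`. -/
local notation "M[" N "]" => Matrix (Fin N) (Fin N) ℂ

open B7Prop1Explicit renaming Site → LSite
open B7Prop2SpecialUnitary (specialUnitaryUnits thetaN)
open B13Inv214OrbitSUN (OrbitConstOnIn SiteGaugeInvSU)
open B10Eq29TubeLine (TubeCfg)
open B10Eq32AxialSuN (BoxBond boxEnds)
open B10Eq32RegularSuN (regSU located26_strictly_weaker)

/-- **A FUNCTION SEPARATING LOCATED FROM GLOBAL (26) IS HOLOMORPHIC ON NO BONDWISE TUBE** (`α′ > 0`; contrapositive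
of §3). [folklore] -/
theorem not_differentiableOn_tubeCfg_of_separating {lo hi : LSite d} {α' : ℝ} (hα' : 0 < α')
    {F : (BoxBond lo hi → M[N]) → ℂ}
    (h26 : OrbitConstOnIn (boxEnds lo hi) (specialUnitaryUnits (Fin N)) F (regSU N lo hi α'))
    (hnot : ¬ SiteGaugeInvSU (boxEnds lo hi) F) {a : ℝ} (ha : 0 < a) :
    ¬ DifferentiableOn ℂ F (TubeCfg (BoxBond lo hi) M[N] a) := fun hF =>
  hnot (siteGaugeInvSU_of_orbitConstOnIn_regSU hα' ha hF h26)

/-- **GEN 28'S WITNESSES, REVISITED** (unit square of `ℤ²`, `0 < α′ < |e^{2πi/N} − 1|`): separating functions exist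
(gen 28's `located26_strictly_weaker` BY NAME) and NONE of them is holomorphic on any bondwise tube — the strictness
lives outside the class of functions the joint theorems quantify over. [folklore] -/
theorem located26_strictly_weaker_only_off_tube {α' : ℝ} (h0 : 0 < α') (hα' : α' < ‖Complex.exp (thetaN N) - 1‖) :
    (∃ F : (BoxBond (0 : LSite 2) 1 → M[N]) → ℂ,
      OrbitConstOnIn (boxEnds 0 1) (specialUnitaryUnits (Fin N)) F (regSU N 0 1 α') ∧
        ¬ SiteGaugeInvSU (boxEnds 0 1) F) ∧
    ∀ F : (BoxBond (0 : LSite 2) 1 → M[N]) → ℂ,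
      OrbitConstOnIn (boxEnds 0 1) (specialUnitaryUnits (Fin N)) F (regSU N 0 1 α') →
        ¬ SiteGaugeInvSU (boxEnds 0 1) F → ∀ a : ℝ, 0 < a → ¬ DifferentiableOn ℂ F (TubeCfg (BoxBond 0 1) M[N] a) :=
  ⟨located26_strictly_weaker N h0.le hα', fun _ h26 hnot _ ha => not_differentiableOn_tubeCfg_of_separating h0 h26 hnot ha⟩

end teeth

end Literature.MathematicalPhysics.QuantumFieldTheory.Balaban1983to89.B10Eq26SuSlice
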